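import Mathlib.Computability.RE
import Mathlib.Combinatorics.SimpleGraph.Maps
import Literature.Computability.Complexity.Classes
import Literature.Computability.Complexity.GraphEncodings
import Literature.Computability.MetaComplexity.UniversalMachine
import HarnessLib

/-!
# Logics capturing PTIME on finite graphs (Gurevich 1988): the abstract notion of a logic and
the `captures` predicate

Topic `Literature/ModelTheory/FiniteModelTheory`; definition request `wi-03766` (route
PneNP/Descriptive; the route's thesis is the NON-existence of such a logic, so existence is kept
OUT of the structure).

Gurevich (1988, §1; Blass–Gurevich–Shelah 1999, §1; Grohe 2008, §2) calls a LOGIC (for PTIME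
purposes) a pair `(Sen, ⊨)` where `Sen` is a DECIDABLE set of (codes of) sentences and `⊨` an
ISOMORPHISM-INVARIANT satisfaction relation between finite structures and sentences, which is
moreover EFFECTIVELY POLYNOMIAL-TIME: there is a computable map associating with every sentence
`φ` a machine `M_φ` and a polynomial `p_φ` such that `M_φ` decides `{𝔄 | 𝔄 ⊨ φ}` (on codes of
structures) within time `p_φ`. Such a logic CAPTURES PTIME if, in addition, every
isomorphism-closed polynomial-time decidable class of finite structures is the model class of a
sentence. (The effectivity of `φ ↦ (M_φ, p_φ)` is essential: without it the "logic" whose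
sentences are all clocked machines, with `⊨` switched off on the non-invariant ones, would
trivially capture PTIME.)

We render this over finite GRAPHS `⟨n, G⟩ : Σ n, SimpleGraph (Fin n)` (graphs suffice: Gurevich's
question for graphs is equivalent to the one for arbitrary finite vocabularies), with the tree's
adjacency-matrix encoding `Literature.Computability.Complexity.encodingGraph`, the tree's class `Literature.Computability.Complexity.Classes.P`, and —
for "machine `M_φ` given by a CODE" — the tree's hypothesis structure of a clocked efficient
universal machine `U : Literature.CplxMeta.UniversalMachine` (`UniversalMachine.lean`): `M_φ` is a
program `e_φ : List Bool` for `U`, its polynomial is `n^{k_φ} + k_φ`, and the requirement is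
`U.run (boolPair e_φ ⌜G⌝) (|⌜G⌝|^{k_φ} + k_φ) = some [b]` with `b ↔ G ⊨ φ`. All admissible `U`
simulate each other with polynomial overhead (`UniversalMachine.sim`, `.polyTime`), so the
notion does not depend on `U` up to that overhead; statements quantify over `U`.

* `IsIsoClosed C` — a class of finite graphs closed under graph isomorphism;
* `graphClassLanguage C` — its language of codes;
* `GurevichLogic U` — the structure `(Sen, sen_computable, Sat, sat_iso, compile,
  compile_computable, compile_spec)`;
* `GurevichLogic.ModelClass L φ`, `CapturesPTIMEOnGraphs U L`, and the route-facing Prop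
  `ExistsLogicCapturingPTIME U := ∃ L, CapturesPTIMEOnGraphs U L` (Gurevich's conjecture is its
  negation; NOT asserted either way).
* PROVED: model classes are iso-closed; the EMPTY logic (no sentences) inhabits the structure
  (non-vacuity of the axioms, not of capturing).

## References

* Y. Gurevich, *Logic and the challenge of computer science*, in: Current Trends in Theoretical
  Computer Science (1988), 1–57, §1 (Def. of a logic capturing PTIME; Conjecture).
* A. Blass, Y. Gurevich, S. Shelah, *Choiceless polynomial time*, Ann. Pure Appl. Logic 100
  (1999), arXiv:math/9705225, §1.
* M. Grohe, *The quest for a logic capturing PTIME*, LICS 2008, §2.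
* R. Fagin, *Generalized first-order spectra and polynomial-time recognizable sets*, SIAM–AMS
  Proc. 7 (1974) (`∃SO = NP`, the model for "capturing").
-/

noncomputable section

open Computability Literature.Computability.Complexity Literature.Computability.Complexity.Classes Literature.Computability.MetaComplexity

namespace Literature.ModelTheory.FiniteModelTheory

/-- The type of finite graphs (vertex set `Fin n`). [Grohe 2008, §2] [folklore] -/
abbrev FinGraph : Type := Σ n : ℕ, SimpleGraph (Fin n)

/-! ### Isomorphism-closed classes and their languages -/

/-- A class of finite graphs is ISOMORPHISM-CLOSED. [Gurevich 1988, §1; Grohe 2008, §2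
("properties of structures are isomorphism-invariant")] [folklore] -/
def IsIsoClosed (C : Set FinGraph) : Prop :=
  ∀ ⦃n m : ℕ⦄ (G : SimpleGraph (Fin n)) (H : SimpleGraph (Fin m)),
    Nonempty (G ≃g H) → (⟨n, G⟩ ∈ C ↔ ⟨m, H⟩ ∈ C)

/-- The language of codes of a class of finite graphs (adjacency-matrix encoding
`encodingGraph`). [Grohe 2008, §2 (structures as strings); Arora–Barak 2009, §0.1] [folklore] -/
def graphClassLanguage (C : Set FinGraph) : Language Bool :=
  {w | ∃ G ∈ C, encodingGraph.encode G = w}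

/-- A class of finite graphs is POLYNOMIAL-TIME DECIDABLE: its language of codes is in the tree's
`P`. [Gurevich 1988, §1; Grohe 2008, §2] [folklore] -/
def IsPTIMEClass (C : Set FinGraph) : Prop :=
  graphClassLanguage C ∈ P

/-! ### Gurevich logics -/

/-- **A logic in the sense of Gurevich (for PTIME on graphs)**, relative to a clocked universal
machine `U`: a computably decidable set `Sen` of sentence codes; an isomorphism-invariant
satisfaction relation `Sat`; and an EFFECTIVE polynomial-time evaluation — a computable
`compile : φ ↦ (e_φ, k_φ)` such that for `φ ∈ Sen` the `U`-program `e_φ` decides `G ⊨ φ` on the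
code of every finite graph `G` within `|⌜G⌝|^{k_φ} + k_φ` steps. No existence or capturing claim
is part of the structure. [Gurevich 1988, §1 (Definition of a logic; "PTIME logic");
Blass–Gurevich–Shelah 1999, §1; Grohe 2008, §2] [cite: Gurevich1988, §1] -/
structure GurevichLogic (U : UniversalMachine) where
  /-- The set of (codes of) sentences. -/
  Sen : Set (List Bool)
  /-- Sentencehood is decidable (recursive syntax). -/
  sen_computable : ComputablePred (· ∈ Sen)
  /-- Satisfaction `G ⊨ φ` for finite graphs `G` and strings `φ`. -/
  Sat : FinGraph → List Bool → Prop
  /-- Isomorphism invariance of satisfaction. -/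
  sat_iso : ∀ ⦃n m : ℕ⦄ (G : SimpleGraph (Fin n)) (H : SimpleGraph (Fin m)),
    Nonempty (G ≃g H) → ∀ φ, Sat ⟨n, G⟩ φ ↔ Sat ⟨m, H⟩ φ
  /-- The effective evaluator: sentence ↦ (program for `U`, exponent). -/
  compile : List Bool → List Bool × ℕ
  /-- The evaluator map is computable. -/
  compile_computable : Computable compile
  /-- For a sentence `φ`, the program `(compile φ).1` run by `U` on the code of any finite graph
  `G` with budget `|⌜G⌝|^k + k`, `k = (compile φ).2`, outputs one bit, which is `true` iff
  `G ⊨ φ`. -/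
  compile_spec : ∀ φ ∈ Sen, ∀ G : FinGraph, ∃ b : Bool,
    U.run (boolPair (compile φ).1 (encodingGraph.encode G))
        ((encodingGraph.encode G).length ^ (compile φ).2 + (compile φ).2) = some [b] ∧
      (b = true ↔ Sat G φ)

namespace GurevichLogic

variable {U : UniversalMachine} (L : GurevichLogic U)

/-- The model class `Mod(φ) = {G | G ⊨ φ}` of a string `φ`. [Gurevich 1988, §1] [folklore] -/
def ModelClass (φ : List Bool) : Set FinGraph :=
  {G | L.Sat G φ}

/-- Model classes are isomorphism-closed. [Gurevich 1988, §1] [folklore] -/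
theorem isIsoClosed_modelClass (φ : List Bool) : IsIsoClosed (L.ModelClass φ) :=
  fun _ _ G H h => L.sat_iso G H h φ

end GurevichLogic

/-- **`L` captures PTIME on finite graphs**: every isomorphism-closed polynomial-time decidable
class of finite graphs is the model class of some sentence of `L`. (The converse inclusion — model
classes of sentences are in PTIME — is built into `GurevichLogic.compile_spec` together with the
efficiency of `U`.) [Gurevich 1988, §1; Blass–Gurevich–Shelah 1999, §1; Grohe 2008, §2] [cite: arXivmath9705225, §1] -/
def CapturesPTIMEOnGraphs {U : UniversalMachine} (L : GurevichLogic U) : Prop :=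
  ∀ C : Set FinGraph, IsIsoClosed C → IsPTIMEClass C → ∃ φ ∈ L.Sen, L.ModelClass φ = C

/-- **"There is a logic capturing PTIME (on graphs)"**, relative to the universal machine `U`.
Gurevich's conjecture (1988) is the NEGATION of this statement; neither is asserted here.
[Gurevich 1988, §1 (Conjecture); Grohe 2008, §2] [cite: arXivmath9705225, §1] -/
def ExistsLogicCapturingPTIME (U : UniversalMachine) : Prop :=
  ∃ L : GurevichLogic U, CapturesPTIMEOnGraphs L

/-! ### API -/

/-- The language of the empty class contains no word. [folklore] -/
@[simp] theorem notMem_graphClassLanguage_empty (w : List Bool) : w ∉ graphClassLanguage ∅ := by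
  rintro ⟨G, hG, -⟩
  exact hG

/-- The empty class and the class of all graphs are isomorphism-closed. [folklore] -/
theorem isIsoClosed_empty : IsIsoClosed ∅ := fun _ _ _ _ _ => by simp

/-- See `isIsoClosed_empty`. [folklore] -/
theorem isIsoClosed_univ : IsIsoClosed Set.univ := fun _ _ _ _ _ => by simp

/-- **The empty logic** (no sentences; satisfaction never holds; trivial evaluator) satisfies the
axioms of a Gurevich logic for every `U` — non-vacuity of the STRUCTURE (it captures nothing).
[folklore] -/
def GurevichLogic.empty (U : UniversalMachine) : GurevichLogic U where
  Sen := ∅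
  sen_computable := ⟨fun _ => inferInstanceAs (Decidable False), by
    simpa using (Computable.const false : Computable fun _ : List Bool => false)⟩
  Sat := fun _ _ => False
  sat_iso := fun _ _ _ _ _ _ => Iff.rfl
  compile := fun _ => ([], 0)
  compile_computable := Computable.const _
  compile_spec := fun _ h => absurd h (Set.notMem_empty _)

/-- The empty logic has empty model classes. [folklore] -/
@[simp] theorem GurevichLogic.modelClass_empty (U : UniversalMachine) (φ : List Bool) :
    (GurevichLogic.empty U).ModelClass φ = ∅ := rfl

/-- Capturing, unfolded on a given class. [Gurevich 1988, §1] [folklore] -/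
theorem CapturesPTIMEOnGraphs.exists_sentence {U : UniversalMachine} {L : GurevichLogic U}
    (h : CapturesPTIMEOnGraphs L) {C : Set FinGraph} (hC : IsIsoClosed C) (hP : IsPTIMEClass C) :
    ∃ φ ∈ L.Sen, ∀ G, G ∈ C ↔ L.Sat G φ := by
  obtain ⟨φ, hφ, hM⟩ := h C hC hP
  exact ⟨φ, hφ, fun G => by rw [← hM]; rfl⟩

end Literature.ModelTheory.FiniteModelTheory
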